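import Mathlib
import Summits.ValiantsHypothesis.ValiantsHypothesis.Theorems.NewtonUnitEquationsNewtonTauWeakResidueNormalForm

/-!
# `NewtonUnitEquationsNewtonTauWeakWeightedNormalForm` — weighted exchange normal form of an equality-knapsack maximiser

Registered stub `stub_weightedNormalForm` (piece W2 of THEOREM W) of line `binomial-normal-form` (crux `NewtonTauWeak`,
stmt-ValiantsHypothesis-5904, lead c6): the `ℤ`-weighted twin of `stub_residueNormalForm`.

Setting.  Items `j : Fin N` have weights `1 ≤ g j ≤ c` and real values `c' j`.  DENSITY ORDER "`x` above `y`" :=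
`c' y * g x < c' x * g y ∨ (c' x * g y = c' y * g x ∧ x < y)` (a strict total order); `rk j` := number of items
above `j`; PREFIX `P := {rk < k}`.  `canon k α β` keeps a prefix item `j` iff at least `α (g j)` prefix items of
its weight class lie below it, and adds a non-prefix item `j` iff fewer than `β (g j)` non-prefix items of its
class lie above it.  Claim: a maximiser `J` of `Σ_J c'` over `{J : Σ_J g = v}` has the weight and the value of some
`canon k α β` with `k ≤ N`, `Σ_{a ≤ c} (α a + β a) ≤ 2c` and `α a = β a = 0` off `[1, c]`.

Proof (exchange argument, `WeightedNormalFormAux.normalForm_core`).  (1) `k` := the largest `k ≤ N` with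
`Σ_P g ≤ v`; the deficit `r = v - Σ_P g` is `< c` (the next item weighs `≤ c`).  (2) `J₀` := a maximiser with
`|J₀ \ P|` least; `R := P \ J₀`, `A := J₀ \ P`, so `Σ_A g = Σ_R g + r`.  (3) Zero-sum-freeness: if `∅ ≠ S ⊆ R` and
`T ⊆ A` weigh the same, `(J₀ \ T) ∪ S` is a maximiser with fewer non-prefix items, because prefix densities
dominate: `(Σ_T c')(Σ_S g) ≤ (Σ_S c')(Σ_T g)`.  (4) Hence `|R| + |A| + 1 ≤ 2c` (Steinitz-type lemma
`WeightedNormalFormAux.card_exchange_le` for the signed weights `∓g` on `R ∪ A`: perform the exchanges greedily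
keeping the running weight in `(-c, c]`; the running weights are pairwise distinct integers).
(5) `α a := |R ∩ class a|`, `β a := |A ∩ class a|`: inside a weight class values and densities order alike, so
trading `R`, `A` for the lowest prefix / highest non-prefix items of their classes keeps the weight and does not
lower the value (`WeightedNormalFormAux.class_exchange`: rank bijection and "down-sets are cheapest" for an
abstract strict total order `r`); maximality of `J` gives equality.  [folklore: exchange argument] -/

set_option linter.dupNamespace false

noncomputable section

open scoped BigOperators

namespace Summit.ValiantsHypothesis.ValiantsHypothesis.Theorems.NewtonUnitEquationsNewtonTauWeak

namespace WeightedNormalFormAux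

variable {N : ℕ}

section rank

variable (r : Fin N → Fin N → Prop) [DecidableRel r]
  (hord : ∀ x y z, ¬ r x x ∧ (r x y → r y z → r x z) ∧ (x ≠ y → r x y ∨ r y x)) (S : Finset (Fin N))
include hord

/-- For a strict total order `r` (irreflexive, transitive, total: `hord`) the rank `#{z ∈ S | r z x}` is strictly
monotone along `r` on `S`. [folklore] -/
theorem rank_lt_rank {x y : Fin N} (hx : x ∈ S) (hxy : r x y) : (S.filter (r · x)).card < (S.filter (r · y)).card :=
  Finset.card_lt_card ⟨fun z hz => Finset.mem_filter.2 ⟨(Finset.mem_filter.1 hz).1,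
    (hord z x y).2.1 (Finset.mem_filter.1 hz).2 hxy⟩,
    fun hsub => (hord x x x).1 (Finset.mem_filter.1 (hsub (Finset.mem_filter.2 ⟨hx, hxy⟩))).2⟩

/-- The rank is injective on `S`. [folklore] -/
theorem rank_injOn : Set.InjOn (fun x => (S.filter (r · x)).card) S := fun x hx y hy hxy => by
  by_contra hne
  rcases (hord x y x).2.2 hne with h | h
  · exact absurd hxy (ne_of_lt (rank_lt_rank r hord S hx h))
  · exact absurd hxy (ne_of_gt (rank_lt_rank r hord S hy h))

/-- Exactly `n` elements of `S` have rank `< n`, for `n ≤ |S|` (the rank injects `{rank < n}` into `[0, n)` and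
its complement into `[n, |S|)`). [folklore] -/
theorem card_filter_rank_lt {n : ℕ} (hn : n ≤ S.card) : (S.filter fun x => (S.filter (r · x)).card < n).card = n := by
  have hinj := rank_injOn r hord S
  have h1 : (S.filter fun x => (S.filter (r · x)).card < n).card ≤ (Finset.range n).card :=
    Finset.card_le_card_of_injOn _ (fun x hx => Finset.mem_coe.2 (Finset.mem_range.2 (Finset.mem_filter.1 hx).2))
      (hinj.mono (Finset.coe_subset.2 (Finset.filter_subset _ S)))
  have h2 : (S.filter fun x => ¬ (S.filter (r · x)).card < n).card ≤ (Finset.Ico n S.card).card :=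
    Finset.card_le_card_of_injOn _ (fun x hx => Finset.mem_coe.2 (Finset.mem_Ico.2 ⟨not_lt.1 (Finset.mem_filter.1 hx).2,
      Finset.card_lt_card (Finset.filter_ssubset.2 ⟨x, (Finset.mem_filter.1 hx).1, (hord x x x).1⟩)⟩))
      (hinj.mono (Finset.coe_subset.2 (Finset.filter_subset _ S)))
  have h3 := Finset.card_filter_add_card_filter_not (s := S) (fun x => (S.filter (r · x)).card < n)
  rw [Finset.card_range] at h1; rw [Nat.card_Ico] at h2; omega

/-- **Down-sets are cheapest.**  If `f` is monotone along `r` on `S`, the `|E|` elements of `S` of least rank have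
total `f`-value `≤ Σ_E f`, for every `E ⊆ S`. [folklore] -/
theorem sum_filter_rank_lt_le (f : Fin N → ℝ) (hmono : ∀ x ∈ S, ∀ y ∈ S, r x y → f x ≤ f y)
    {E : Finset (Fin N)} (hE : E ⊆ S) :
    ∑ x ∈ S.filter (fun x => (S.filter (r · x)).card < E.card), f x ≤ ∑ x ∈ E, f x := by
  refine ResidueNormalFormAux.sum_down_le S _ E f hE (card_filter_rank_lt r hord S (Finset.card_le_card hE))
    fun x hx y hy hyD => ?_
  have hne : x ≠ y := fun hxy => hyD (hxy ▸ hx)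
  rcases (hord x y x).2.2 hne with h | h
  · exact hmono x (Finset.mem_filter.1 hx).1 y hy h
  · exact absurd (Finset.mem_filter.2 ⟨hy, (rank_lt_rank r hord S hy h).trans (Finset.mem_filter.1 hx).2⟩) hyD

/-- **Class-wise exchange.**  Replace `E ⊆ B` by the items of `B` that are among the `|E ∩ class|` `r`-first items
of their weight class (`g` = weight): the weight is unchanged, and the `f`-value does not go up when `f` is
monotone along `r` inside each class. [folklore] -/
theorem class_exchange (g : Fin N → ℕ) (f : Fin N → ℝ) (B E : Finset (Fin N)) (hE : E ⊆ B)
    (hmono : ∀ x ∈ B, ∀ y ∈ B, g x = g y → r x y → f x ≤ f y) (m : ℕ → ℕ)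
    (hm : ∀ a, m a = (E.filter fun j => g j = a).card) :
    ∑ j ∈ B.filter (fun j => ((B.filter fun j' => g j' = g j).filter (r · j)).card < m (g j)), g j =
        ∑ j ∈ E, g j ∧
      ∑ j ∈ B.filter (fun j => ((B.filter fun j' => g j' = g j).filter (r · j)).card < m (g j)), f j ≤
        ∑ j ∈ E, f j := by
  obtain ⟨X, hX⟩ : ∃ X : Finset (Fin N),
      X = B.filter fun j => ((B.filter fun j' => g j' = g j).filter (r · j)).card < m (g j) := ⟨_, rfl⟩
  rw [← hX]
  have hXa : ∀ a, X.filter (fun j => g j = a) = (B.filter fun j => g j = a).filter fun j =>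
      ((B.filter fun j' => g j' = a).filter (r · j)).card < (E.filter fun j => g j = a).card := fun a => by
    ext j
    simp only [hX, Finset.mem_filter, hm]
    exact ⟨fun ⟨⟨hjB, hlt⟩, hja⟩ => ⟨⟨hjB, hja⟩, hja ▸ hlt⟩, fun ⟨⟨hjB, hja⟩, hlt⟩ => ⟨⟨hjB, hja ▸ hlt⟩, hja⟩⟩
  have hsub : ∀ a, (E.filter fun j => g j = a) ⊆ B.filter fun j => g j = a :=
    fun a => Finset.filter_subset_filter _ hE
  have hmaps : ∀ (Y : Finset (Fin N)), ∀ j ∈ Y, g j ∈ Finset.univ.image g :=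
    fun Y j _ => Finset.mem_image_of_mem g (Finset.mem_univ j)
  rw [← Finset.sum_fiberwise_of_maps_to (hmaps X) g, ← Finset.sum_fiberwise_of_maps_to (hmaps E) g,
    ← Finset.sum_fiberwise_of_maps_to (hmaps X) f, ← Finset.sum_fiberwise_of_maps_to (hmaps E) f]
  refine ⟨Finset.sum_congr rfl fun a _ => ?_, Finset.sum_le_sum fun a _ => ?_⟩
  · rw [Finset.sum_congr rfl fun j hj => (Finset.mem_filter.1 hj).2,
      Finset.sum_congr rfl fun j hj => (Finset.mem_filter.1 hj).2, Finset.sum_const, Finset.sum_const, hXa,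
      card_filter_rank_lt r hord _ (Finset.card_le_card (hsub a))]
  · rw [hXa]
    exact sum_filter_rank_lt_le r hord _ f (fun x hx y hy hxy => hmono x (Finset.mem_filter.1 hx).1 y
      (Finset.mem_filter.1 hy).1 ((Finset.mem_filter.1 hx).2.trans (Finset.mem_filter.1 hy).2.symm) hxy) (hsub a)

end rank

/-- **Zero-sum-free exchanges are short** (Steinitz-type lemma, inductive form).  Signed weights `e j`,
`1 ≤ |e j| ≤ c`; `U` = exchanges still to be performed, `s ∈ (-c, c]` = current running weight, `Past ⊆ (-c, c]` =
earlier running weights, final running weight `r < c`.  If no nonempty `V ⊆ U` brings the running weight back to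
`s` and no `V ⊆ U` brings it into `Past`, then `|Past| + 1 + |U| ≤ 2c`: greedily perform a positive exchange while
`s ≤ 0` and a negative one while `s > 0` (forced moves at the ends); the new running weight is fresh and stays in
`(-c, c]`. [folklore] -/
theorem card_exchange_le (e : Fin N → ℤ) (c r : ℕ) (he : ∀ j, (1 ≤ e j ∧ e j ≤ c) ∨ (1 ≤ -e j ∧ -e j ≤ c))
    (hrc : r < c) :
    ∀ (n : ℕ) (U : Finset (Fin N)) (Past : Finset ℤ) (s : ℤ), U.card = n → -(c : ℤ) < s → s ≤ c →
      Past ⊆ Finset.Ioc (-(c : ℤ)) c → (∑ j ∈ U, e j) + s = r →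
      (∀ V ⊆ U, (s + ∑ j ∈ V, e j = s → V = ∅) ∧ s + ∑ j ∈ V, e j ∉ Past) →
      (insert s Past).card + n ≤ 2 * c := by
  intro n
  induction n with
  | zero =>
    intro U Past s _ h1 h2 hPast _ _
    have h := Finset.card_le_card (Finset.insert_subset_iff.2 ⟨Finset.mem_Ioc.2 ⟨h1, h2⟩, hPast⟩)
    rw [Int.card_Ioc] at h; omega
  | succ n ih =>
    intro U Past s hcard h1 h2 hPast hsum hfree
    rw [Finset.card_insert_of_notMem (by simpa using (hfree ∅ (Finset.empty_subset U)).2)]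
    -- one greedy step: perform `z ∈ U`, provided the new running weight `s + e z` stays in `(-c, c]`
    have hstep : ∀ z ∈ U, -(c : ℤ) < s + e z → s + e z ≤ c → Past.card + 1 + (n + 1) ≤ 2 * c := by
      intro z hz hz1 hz2
      have hV : ∀ V ⊆ U.erase z, z ∉ V ∧ insert z V ⊆ U := fun V hV =>
        ⟨fun h => Finset.notMem_erase z U (hV h), Finset.insert_subset hz (hV.trans (Finset.erase_subset z U))⟩
      have hcond : ∀ V ⊆ U.erase z, (s + e z + ∑ j ∈ V, e j = s + e z → V = ∅) ∧
          s + e z + ∑ j ∈ V, e j ∉ insert s Past := by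
        intro V hVU
        have hE : s + e z + ∑ j ∈ V, e j = s + ∑ j ∈ insert z V, e j := by
          rw [Finset.sum_insert (hV V hVU).1]
          ring
        refine ⟨fun h => (hfree V (hVU.trans (Finset.erase_subset z U))).1 (by linarith), fun h => ?_⟩
        rw [hE, Finset.mem_insert] at h
        exact h.elim (fun h => Finset.insert_ne_empty z V ((hfree _ (hV V hVU).2).1 h)) (hfree _ (hV V hVU).2).2
      have key := ih (U.erase z) (insert s Past) (s + e z) (by rw [Finset.card_erase_of_mem hz]; omega) hz1 hz2
        (Finset.insert_subset_iff.2 ⟨Finset.mem_Ioc.2 ⟨h1, h2⟩, hPast⟩)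
        (by rw [← Finset.sum_erase_add U e hz] at hsum; linarith) hcond
      rw [Finset.card_insert_of_notMem (by simpa using (hcond ∅ (Finset.empty_subset _)).2),
        Finset.card_insert_of_notMem (by simpa using (hfree ∅ (Finset.empty_subset U)).2)] at key
      omega
    -- the greedy rule (`z₀`: the forced move when all remaining exchanges have the wrong sign)
    obtain ⟨z₀, hz₀⟩ : U.Nonempty := Finset.card_pos.1 (by omega)
    have hsum₀ := Finset.sum_erase_add U e hz₀
    by_cases hs0 : s ≤ 0
    · by_cases hex : ∃ z ∈ U, 0 < e z
      · obtain ⟨z, hz, hez⟩ := hex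
        rcases he z with h | h <;> [exact hstep z hz (by omega) (by omega); omega]
      · push Not at hex
        have h0 : ∑ j ∈ U.erase z₀, e j ≤ 0 := Finset.sum_nonpos fun j hj => hex j (Finset.mem_of_mem_erase hj)
        rcases he z₀ with h | h <;> [exact absurd (hex z₀ hz₀) (by omega); exact hstep z₀ hz₀ (by omega) (by omega)]
    · by_cases hex : ∃ z ∈ U, e z < 0
      · obtain ⟨z, hz, hez⟩ := hex
        rcases he z with h | h <;> [omega; exact hstep z hz (by omega) (by omega)]
      · push Not at hex
        have h0 : 0 ≤ ∑ j ∈ U.erase z₀, e j := Finset.sum_nonneg fun j hj => hex j (Finset.mem_of_mem_erase hj)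
        rcases he z₀ with h | h <;> [exact hstep z₀ hz₀ (by omega) (by omega); exact absurd (hex z₀ hz₀) (by omega)]

/-- The density order "above" is the lexicographic order of the key `(-c' x / g x, x)`. [folklore] -/
theorem above_iff (g : Fin N → ℕ) (c' : Fin N → ℝ) (hg : ∀ j, (0 : ℝ) < g j) (x y : Fin N) :
    (c' y * (g x : ℝ) < c' x * (g y : ℝ) ∨ (c' x * (g y : ℝ) = c' y * (g x : ℝ) ∧ x < y)) ↔
      (-c' x / g x < -c' y / g y ∨ (-c' x / g x = -c' y / g y ∧ x < y)) := by
  rw [div_lt_div_iff₀ (hg x) (hg y), div_eq_div_iff (hg x).ne' (hg y).ne', neg_mul, neg_mul, neg_lt_neg_iff,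
    neg_inj]

/-- **Weighted exchange normal form, abstract order.**  The statement of `stub_weightedNormalForm` for an abstract
strict total order `D` ("above") along which densities are monotone (`hdom`); `rk` and `canon` are characterised
by `hrk`, `hcanon`.  Proof in the module docstring. [folklore: exchange argument] -/
theorem normalForm_core (c v : ℕ) (g : Fin N → ℕ) (hg : ∀ j, 1 ≤ g j ∧ g j ≤ c)
    (c' : Fin N → ℝ) (J : Finset (Fin N)) (hJ : ∑ j ∈ J, g j = v)
    (hmax : ∀ J' : Finset (Fin N), ∑ j ∈ J', g j = v → ∑ j ∈ J', c' j ≤ ∑ j ∈ J, c' j)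
    (D : Fin N → Fin N → Prop) [DecidableRel D]
    (hord : ∀ x y z, ¬ D x x ∧ (D x y → D y z → D x z) ∧ (x ≠ y → D x y ∨ D y x))
    (hdom : ∀ x y, D x y → c' y * (g x : ℝ) ≤ c' x * (g y : ℝ))
    (rk : Fin N → ℕ) (hrk : ∀ j, rk j = (Finset.univ.filter (D · j)).card)
    (canon : ℕ → (ℕ → ℕ) → (ℕ → ℕ) → Finset (Fin N))
    (hcanon : ∀ k α β, canon k α β = Finset.univ.filter fun j : Fin N =>
        (rk j < k ∧ α (g j) ≤ (Finset.univ.filter fun j' : Fin N => rk j' < k ∧ g j' = g j ∧ D j j').card) ∨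
        (k ≤ rk j ∧ (Finset.univ.filter fun j' : Fin N => k ≤ rk j' ∧ g j' = g j ∧ D j' j).card < β (g j))) :
    ∃ (k : ℕ) (α β : ℕ → ℕ), k ≤ N ∧ (∑ a ∈ Finset.range (c + 1), (α a + β a) ≤ 2 * c) ∧
      (∀ a, (a = 0 ∨ c < a) → α a = 0 ∧ β a = 0) ∧
      ∑ j ∈ canon k α β, g j = v ∧ ∑ j ∈ canon k α β, c' j = ∑ j ∈ J, c' j := by
  -- degenerate case `c = 0`: there are no items at all
  rcases Nat.eq_zero_or_pos c with hc | hc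
  · have hN : IsEmpty (Fin N) := ⟨fun j => by have := hg j; omega⟩
    have h0 : ∀ X : Finset (Fin N), X = ∅ := fun X => Finset.eq_empty_of_isEmpty X
    refine ⟨0, fun _ => 0, fun _ => 0, Nat.zero_le N, by simp, fun _ _ => ⟨rfl, rfl⟩, ?_, ?_⟩
    · rw [h0 (canon _ _ _), Finset.sum_empty, ← hJ, h0 J, Finset.sum_empty]
    · rw [h0 (canon _ _ _), h0 J]
  have hgpos : ∀ j, (0 : ℝ) < g j := fun j => Nat.cast_pos.2 (hg j).1
  -- inside a weight class, "above" means "at least as valuable"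
  have hcls : ∀ x y, g x = g y → D x y → c' y ≤ c' x := fun x y hxy h =>
    le_of_mul_le_mul_right (a := (g y : ℝ)) (by have h' := hdom x y h; rwa [hxy] at h') (hgpos y)
  have hord' : ∀ x y z, ¬ D x x ∧ (D y x → D z y → D z x) ∧ (x ≠ y → D y x ∨ D x y) :=
    fun x y z => ⟨(hord x x x).1, fun h₁ h₂ => (hord z y x).2.1 h₂ h₁, fun hne => ((hord x y x).2.2 hne).symm⟩
  have habove : ∀ s t, rk s < rk t → D s t := fun s t h => by
    rcases eq_or_ne s t with rfl | hne
    · exact absurd h (lt_irrefl _)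
    refine ((hord s t s).2.2 hne).resolve_right fun h' => ?_
    have := rank_lt_rank D hord Finset.univ (Finset.mem_univ t) h'
    rw [← hrk, ← hrk] at this; omega
  -- (1) the longest prefix `P = {rk < k}` of weight `≤ v`; its deficit `r` is `< c`
  obtain ⟨w, hw⟩ : ∃ w : ℕ → ℕ, ∀ k, w k = ∑ j ∈ Finset.univ.filter (fun j => rk j < k), g j :=
    ⟨_, fun _ => rfl⟩
  obtain ⟨k, hk⟩ : ∃ k, Nat.findGreatest (fun k => w k ≤ v) N = k := ⟨_, rfl⟩
  have hkN : k ≤ N := hk ▸ Nat.findGreatest_le N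
  obtain ⟨P, hP⟩ : ∃ P : Finset (Fin N), P = Finset.univ.filter fun j => rk j < k := ⟨_, rfl⟩
  have memP : ∀ j, j ∈ P ↔ rk j < k := fun j => by rw [hP]; simp
  have hPv : ∑ j ∈ P, g j ≤ v := by
    have h := Nat.findGreatest_spec (P := fun k => w k ≤ v) (Nat.zero_le N) (by simp [hw])
    rwa [hk, hw, ← hP] at h
  obtain ⟨r, hr⟩ : ∃ r, ∑ j ∈ P, g j + r = v := ⟨v - ∑ j ∈ P, g j, by omega⟩
  have hrc : r < c := by
    rcases hkN.lt_or_eq with hlt | heq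
    · have hnot : ¬ ∑ j ∈ Finset.univ.filter (fun j => rk j < k + 1), g j ≤ v := by
        rw [← hw]
        exact Nat.findGreatest_is_greatest (P := fun k => w k ≤ v) (n := N) (k := k + 1) (by omega) (by omega)
      obtain ⟨j₁, hj₁k, hj₁⟩ : ∃ j₁, rk j₁ < k + 1 ∧ ¬ rk j₁ < k := by
        by_contra h
        push Not at h
        exact hnot ((Finset.sum_le_sum_of_subset fun j hj => (memP j).2 (h j (Finset.mem_filter.1 hj).2)).trans hPv)
      have hins : (Finset.univ.filter fun j => rk j < k + 1) ⊆ insert j₁ P := fun j hj => by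
        rw [Finset.mem_insert, memP, or_iff_not_imp_right]
        refine fun hne => rank_injOn D hord Finset.univ (Finset.mem_univ j) (Finset.mem_univ j₁) ?_
        show (Finset.univ.filter (D · j)).card = (Finset.univ.filter (D · j₁)).card
        have := (Finset.mem_filter.1 hj).2
        rw [← hrk, ← hrk]; omega
      have hle := Finset.sum_le_sum_of_subset (f := g) hins
      rw [Finset.sum_insert fun h => hj₁ ((memP j₁).1 h)] at hle
      have := (hg j₁).2; omega
    · have hJP : J ⊆ P := fun j _ => (memP j).2 (by
        have h : (Finset.univ.filter (D · j)).card < (Finset.univ : Finset (Fin N)).card :=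
          Finset.card_lt_card (Finset.filter_ssubset.2 ⟨j, Finset.mem_univ j, (hord j j j).1⟩)
        rw [heq, hrk]; simpa using h)
      have := Finset.sum_le_sum_of_subset (f := g) hJP
      omega
  -- (2) the maximiser `J₀` with fewest non-prefix items; `R = P \ J₀`, `A = J₀ \ P`, `Σ_A g = Σ_R g + r`
  obtain ⟨J₀, hJ₀M, hmin⟩ := Finset.exists_min_image ((Finset.univ : Finset (Finset (Fin N))).filter
    fun J' => ∑ j ∈ J', g j = v ∧ ∑ j ∈ J', c' j = ∑ j ∈ J, c' j) (fun J' => (J' \ P).card) ⟨J, by simp [hJ]⟩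
  simp only [Finset.mem_filter, Finset.mem_univ, true_and] at hJ₀M hmin
  have hPJg := Finset.sum_inter_add_sum_sdiff P J₀ g; have hPJc := Finset.sum_inter_add_sum_sdiff P J₀ c'
  have hJPg := Finset.sum_inter_add_sum_sdiff J₀ P g; have hJPc := Finset.sum_inter_add_sum_sdiff J₀ P c'
  rw [Finset.inter_comm] at hJPg hJPc
  have hRA : ∑ j ∈ J₀ \ P, g j = ∑ j ∈ P \ J₀, g j + r := by omega
  have hdisjRA : Disjoint (P \ J₀) (J₀ \ P) :=
    Finset.disjoint_left.2 fun x hx hx' => (Finset.mem_sdiff.1 hx').2 (Finset.mem_sdiff.1 hx).1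
  -- (3) zero-sum-freeness: swapping equal weights back would give a maximiser with fewer non-prefix items
  have hfree : ∀ S ⊆ P \ J₀, ∀ T ⊆ J₀ \ P, ∑ j ∈ S, g j = ∑ j ∈ T, g j → S = ∅ := by
    intro S hS T hT heq
    refine S.eq_empty_or_nonempty.resolve_right fun hSne => ?_
    have hS' : ∀ s ∈ S, rk s < k ∧ s ∉ J₀ := fun s hs => by simpa [memP] using hS hs
    have hT' : ∀ t ∈ T, t ∈ J₀ ∧ k ≤ rk t := fun t ht => by simpa [memP] using hT ht
    have hSpos : 0 < ∑ i ∈ S, g i := Finset.sum_pos (fun i _ => (hg i).1) hSne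
    -- prefix densities dominate: `(Σ_T c') (Σ_S g) ≤ (Σ_T g) (Σ_S c')`, and the two weights agree
    have hval : (∑ t ∈ T, c' t) * (∑ s ∈ S, (g s : ℝ)) ≤ (∑ t ∈ T, (g t : ℝ)) * (∑ s ∈ S, c' s) := by
      rw [Finset.sum_mul_sum, Finset.sum_mul_sum]
      refine Finset.sum_le_sum fun t ht => Finset.sum_le_sum fun s hs => ?_
      rw [mul_comm ((g t : ℕ) : ℝ)]
      exact hdom s t (habove s t (by have := (hS' s hs).1; have := (hT' t ht).2; omega))
    rw [show (∑ t ∈ T, (g t : ℝ)) = ∑ s ∈ S, (g s : ℝ) by exact_mod_cast heq.symm, mul_comm (∑ s ∈ S, (g s : ℝ))]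
      at hval
    replace hval := le_of_mul_le_mul_right hval (by exact_mod_cast hSpos)
    have hdisj : Disjoint (J₀ \ T) S :=
      Finset.disjoint_left.2 fun x hx hxS => (hS' x hxS).2 (Finset.mem_sdiff.1 hx).1
    have hTJ : T ⊆ J₀ := fun t ht => (hT' t ht).1
    have hsg := Finset.sum_sdiff (f := g) hTJ; have hsc := Finset.sum_sdiff (f := c') hTJ
    have hw1 : ∑ j ∈ (J₀ \ T) ∪ S, g j = v := by rw [Finset.sum_union hdisj]; omega
    have hle := hmin _ ⟨hw1, le_antisymm (hmax _ hw1) (by rw [Finset.sum_union hdisj]; linarith)⟩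
    have h2 : ((J₀ \ T) ∪ S) \ P ⊆ (J₀ \ P) \ T := fun x hx => by
      simp only [Finset.mem_sdiff, Finset.mem_union, memP] at hx ⊢
      exact hx.1.elim (fun h => ⟨⟨h.1, hx.2⟩, h.2⟩) fun h => absurd (hS' x h).1 hx.2
    have h3 := Finset.card_le_card h2
    rw [Finset.card_sdiff_of_subset hT] at h3
    have h4 := Finset.card_le_card hT
    have h5 := (Finset.nonempty_of_sum_ne_zero (heq ▸ hSpos.ne')).card_pos
    omega
  -- (4) hence `|R| + |A| + 1 ≤ 2c`, by `card_exchange_le` for the signed weights `∓g` on `R ∪ A`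
  have hRAc : (P \ J₀).card + (J₀ \ P).card + 1 ≤ 2 * c := by
    have hem : ∀ X ⊆ P \ J₀, ∀ Y ⊆ J₀ \ P, ∑ j ∈ X ∪ Y, (if j ∈ P then -(g j : ℤ) else (g j : ℤ)) =
        (∑ j ∈ Y, (g j : ℤ)) - ∑ j ∈ X, (g j : ℤ) := fun X hX Y hY => by
      rw [Finset.sum_union (hdisjRA.mono hX hY), Finset.sum_congr rfl fun j hj => if_pos (Finset.mem_sdiff.1 (hX hj)).1,
        Finset.sum_congr rfl fun j hj => if_neg (Finset.mem_sdiff.1 (hY hj)).2, Finset.sum_neg_distrib]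
      ring
    have hRA' : (∑ j ∈ J₀ \ P, (g j : ℤ)) = ∑ j ∈ P \ J₀, (g j : ℤ) + r := by exact_mod_cast hRA
    have key := card_exchange_le (fun j => if j ∈ P then -(g j : ℤ) else (g j : ℤ)) c r
      (fun j => by have := hg j; split_ifs <;> omega) hrc _ ((P \ J₀) ∪ (J₀ \ P)) ∅ 0 rfl (by omega) (by omega)
      (Finset.empty_subset _) (by rw [hem _ subset_rfl _ subset_rfl]; linarith)
      fun V hV => ⟨fun h => ?_, Finset.notMem_empty _⟩
    · rw [Finset.insert_empty, Finset.card_singleton, Finset.card_union_of_disjoint hdisjRA] at key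
      omega
    have hVU : V = V ∩ (P \ J₀) ∪ V ∩ (J₀ \ P) := by rw [← Finset.inter_union_distrib_left, Finset.inter_eq_left.2 hV]
    rw [zero_add, hVU, hem _ Finset.inter_subset_right _ Finset.inter_subset_right, sub_eq_zero] at h
    have hS0 := hfree _ Finset.inter_subset_right _ Finset.inter_subset_right (by exact_mod_cast h.symm)
    rw [hS0, Finset.sum_empty, eq_comm] at h
    rw [hVU, hS0, Finset.empty_union]
    refine Finset.eq_empty_of_forall_notMem fun t ht => ?_
    have h1 := Finset.single_le_sum (f := fun j => (g j : ℤ)) (fun j _ => by positivity) ht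
    have := (hg t).1
    omega
  -- (5) the multiplicities `α a = |R ∩ class a|`, `β a = |A ∩ class a|`
  obtain ⟨α, hα⟩ : ∃ α : ℕ → ℕ, ∀ a, α a = ((P \ J₀).filter fun j => g j = a).card := ⟨_, fun _ => rfl⟩
  obtain ⟨β, hβ⟩ : ∃ β : ℕ → ℕ, ∀ a, β a = ((J₀ \ P).filter fun j => g j = a).card := ⟨_, fun _ => rfl⟩
  have hvan : ∀ (X : Finset (Fin N)) (a : ℕ), (a = 0 ∨ c < a) → (X.filter fun j => g j = a).card = 0 :=
    fun X a ha => Finset.card_eq_zero.2 (Finset.filter_eq_empty_iff.2 fun j _ h => by have := hg j; omega)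
  have hfib : ∀ X : Finset (Fin N), ∑ a ∈ Finset.range (c + 1), (X.filter fun j => g j = a).card = X.card :=
    fun X => (Finset.card_eq_sum_card_fiberwise fun j _ => Finset.mem_range.2 (Nat.lt_succ_of_le (hg j).2)).symm
  refine ⟨k, α, β, hkN, ?_, fun a ha => ⟨(hα a).trans (hvan _ a ha), (hβ a).trans (hvan _ a ha)⟩, ?_⟩
  · simp only [Finset.sum_add_distrib, hα, hβ, hfib]
    omega
  -- the canonical set is `(P \ Rm) ∪ Ad`: `Rm` / `Ad` = lowest prefix / highest non-prefix items, class by class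
  obtain ⟨Rm, hRm⟩ : ∃ Rm : Finset (Fin N), Rm = P.filter fun j =>
      ((P.filter fun j' => g j' = g j).filter fun j' => D j j').card < α (g j) := ⟨_, rfl⟩
  obtain ⟨Ad, hAd⟩ : ∃ Ad : Finset (Fin N), Ad = Pᶜ.filter fun j =>
      ((Pᶜ.filter fun j' => g j' = g j).filter fun j' => D j' j).card < β (g j) := ⟨_, rfl⟩
  have hXR := class_exchange (fun x y => D y x) hord' g c' P (P \ J₀) Finset.sdiff_subset
    (fun x _ y _ hxy h => hcls y x hxy.symm h) α hα
  have hXA := class_exchange D hord g (fun j => -c' j) Pᶜ (J₀ \ P)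
    (fun x hx => Finset.mem_compl.2 (Finset.mem_sdiff.1 hx).2) (fun x _ y _ hxy h => neg_le_neg (hcls x y hxy h))
    β hβ
  rw [← hRm] at hXR
  rw [← hAd, Finset.sum_neg_distrib, Finset.sum_neg_distrib, neg_le_neg_iff] at hXA
  obtain ⟨hRmg, hRmc⟩ := hXR
  obtain ⟨hAdg, hAdc⟩ := hXA
  have hK : canon k α β = (P \ Rm) ∪ Ad := by
    rw [hcanon, hRm, hAd, ← Finset.filter_not, hP]
    ext j
    simp only [Finset.mem_filter, Finset.mem_union, Finset.mem_univ, true_and, Finset.compl_filter,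
      Finset.filter_filter, not_lt, and_assoc]
  have hdisjK : Disjoint (P \ Rm) Ad := Finset.disjoint_left.2 fun x hx hx' => by
    rw [hAd, Finset.mem_filter, Finset.mem_compl] at hx'
    exact hx'.1 (Finset.mem_sdiff.1 hx).1
  have hRmP : Rm ⊆ P := hRm ▸ Finset.filter_subset _ P
  have hPg := Finset.sum_sdiff (f := g) hRmP; have hPc := Finset.sum_sdiff (f := c') hRmP
  have hKg : ∑ j ∈ canon k α β, g j = v := by rw [hK, Finset.sum_union hdisjK]; omega
  refine ⟨hKg, le_antisymm (hmax _ hKg) ?_⟩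
  rw [hK, Finset.sum_union hdisjK]
  linarith [hJ₀M.2]

end WeightedNormalFormAux

/-- **Weighted exchange normal form** (THEOREM W of line `binomial-normal-form`, piece W2).  Items `j : Fin N` with
weights `1 ≤ g j ≤ c` and real values `c' j`; density order "`j'` above `j`" :=
`c' j * g j' < c' j' * g j ∨ (c' j' * g j = c' j * g j' ∧ j' < j)`, `rk j` := number of items above `j`, prefix
`k` := `{rk < k}`; `canon k α β` := (prefix items `j` with at least `α (g j)` same-weight prefix items below them) ∪
(non-prefix items `j` with fewer than `β (g j)` same-weight non-prefix items above them).  Every maximiser `J` of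
`Σ_J c'` over `{J : Σ_J g = v}` has the weight and the value of some `canon k α β` with `k ≤ N`,
`Σ_{a ≤ c} (α a + β a) ≤ 2c`, `α, β` vanishing off `[1, c]` (`rk`, `canon` are parameters characterised by `hrk`,
`hcanon`).  Proof: `WeightedNormalFormAux.normalForm_core` for the density order. [folklore: exchange argument] -/
theorem stub_weightedNormalForm (N c v : ℕ) (g : Fin N → ℕ) (hg : ∀ j, 1 ≤ g j ∧ g j ≤ c)
    (c' : Fin N → ℝ) (J : Finset (Fin N)) (hJ : ∑ j ∈ J, g j = v)
    (hmax : ∀ J' : Finset (Fin N), ∑ j ∈ J', g j = v → ∑ j ∈ J', c' j ≤ ∑ j ∈ J, c' j)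
    (rk : Fin N → ℕ)
    (hrk : ∀ j, rk j = (Finset.univ.filter fun j' : Fin N =>
        c' j * (g j' : ℝ) < c' j' * (g j : ℝ) ∨ (c' j' * (g j : ℝ) = c' j * (g j' : ℝ) ∧ j' < j)).card)
    (canon : ℕ → (ℕ → ℕ) → (ℕ → ℕ) → Finset (Fin N))
    (hcanon : ∀ k α β, canon k α β = Finset.univ.filter fun j : Fin N =>
        (rk j < k ∧ α (g j) ≤ (Finset.univ.filter fun j' : Fin N =>
            rk j' < k ∧ g j' = g j ∧
              (c' j' * (g j : ℝ) < c' j * (g j' : ℝ) ∨ (c' j * (g j' : ℝ) = c' j' * (g j : ℝ) ∧ j < j'))).card) ∨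
        (k ≤ rk j ∧ (Finset.univ.filter fun j' : Fin N =>
            k ≤ rk j' ∧ g j' = g j ∧
              (c' j * (g j' : ℝ) < c' j' * (g j : ℝ) ∨ (c' j' * (g j : ℝ) = c' j * (g j' : ℝ) ∧ j' < j))).card
            < β (g j))) :
    ∃ (k : ℕ) (α β : ℕ → ℕ), k ≤ N ∧ (∑ a ∈ Finset.range (c + 1), (α a + β a) ≤ 2 * c) ∧
      (∀ a, (a = 0 ∨ c < a) → α a = 0 ∧ β a = 0) ∧
      ∑ j ∈ canon k α β, g j = v ∧ ∑ j ∈ canon k α β, c' j = ∑ j ∈ J, c' j := by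
  have key := WeightedNormalFormAux.above_iff g c' fun j => Nat.cast_pos.2 (hg j).1
  exact WeightedNormalFormAux.normalForm_core c v g hg c' J hJ hmax
    (fun x y => c' y * (g x : ℝ) < c' x * (g y : ℝ) ∨ (c' x * (g y : ℝ) = c' y * (g x : ℝ) ∧ x < y))
    (fun x y z => ⟨fun h => ResidueNormalFormAux.key_irrefl (fun j => -c' j / g j) x ((key x x).1 h),
      fun h₁ h₂ => (key x z).2
        (ResidueNormalFormAux.key_trans (fun j => -c' j / g j) ((key x y).1 h₁) ((key y z).1 h₂)),
      fun hne => (ResidueNormalFormAux.key_total (fun j => -c' j / g j) hne).imp (key x y).2 (key y x).2⟩)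
    (fun x y h => h.elim le_of_lt fun h' => h'.1.symm.le) rk hrk canon hcanon

end Summit.ValiantsHypothesis.ValiantsHypothesis.Theorems.NewtonUnitEquationsNewtonTauWeak

end
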